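import Summits.QuantumFields.GaugeBoot.Rows.KZL2rpD4RowDefs
import HarnessLib

/-!
# Gauge-boot: kernel check of the H row transport table, part 5/5

Cell `pub-gaugeboot` (HOME `run/shared/lean/pub/pub-gaugeboot/`), seat lean1 (SYMMETRY-FACTORISED torus layer for the kz-L2-rp-4D family =
rows C91–C106 / C123–C127; label set, lines, irrep data, pair/row class certification, orbit tables, reduction identity, assembly).

HONEST FRAMING (page 1 of every file of this cell): certified bounds on lattice expectations at STATED coupling,
gauge group, dimension and torus size; NOT a mass gap, NOT a continuum limit, NOT a string tension, NOT large `N`.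
The venture is explicitly NOT Yang–Mills-summit-bearing (barriers `FixedCouplingUltralocality`,
`PerturbativeInvisibility`).

`RowHOK r b` for rows in ranges and all lines `b` (nested shallow ranges; `decide +kernel`: two `gactT` evaluations per entry);
assembled in `KZL2rpD4RowAsm`.
-/

noncomputable section

open Literature.MathematicalPhysics.QuantumFieldTheory

namespace Summit.QuantumFields.GaugeBoot

namespace KZL2rpD4

set_option maxHeartbeats 0 in
/-- Rows `48 ≤ r < 50` of the H transport table are correct (3554 entries; kernel). -/
theorem rowH_ok_48_50 : ∀ r : Fin 50, 48 ≤ r.val → r.val < 50 → ∀ x : Fin 28, ∀ z : Fin 64, 0 + 64 * x.val + z.val < 1777 → RowHOK r.val (0 + 64 * x.val + z.val) := by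
  decide +kernel

end KZL2rpD4

end Summit.QuantumFields.GaugeBoot

end
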